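import Mathlib.Analysis.Calculus.ContDiff.Basic
import Mathlib.Analysis.Calculus.ContDiff.Operations
import Mathlib.Analysis.Normed.Module.FiniteDimension
import Mathlib.Analysis.SpecialFunctions.Pow.Real
import HarnessLib

/-!
# Mikhlin bounds for homogeneous symbols (Schauder program, item A′-prep)

Topic `Literature/Analysis/FunctionSpaces`. A function `σ : E → F` on a finite-dimensional real
normed space which is `C^∞` off the origin and positively homogeneous of degree `m ∈ ℤ`
(`σ (t • ξ) = t ^ m • σ ξ` for `t > 0`, `ξ ≠ 0`) has derivatives homogeneous of degree `m − N`,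
hence satisfies the **Mikhlin–Hörmander bounds** `‖D^N σ(ξ)‖ ≤ C_N ‖ξ‖^{m−N}` (`ξ ≠ 0`) with
`C_N = sup_{‖η‖=1} ‖D^N σ(η)‖` — the hypothesis of the block multiplier theorem
`Literature.Analysis.FunctionSpaces.exists_eLpNormDistrib_truncSymbol_lpBlock_le`
(Bahouri–Chemin–Danchin 2011, Lemma 2.2). The model case is the parametrix symbol `1/ℓ(ξ)` of a
constant-coefficient elliptic operator (`m = −2`).

* `iteratedFDeriv_comp_smul_of_ne` — chain rule with a dilation off the origin;
* `iteratedFDeriv_smul_eq_of_homogeneous` — `D^N σ (t • ξ) = t^(m−N) • D^N σ (ξ)`;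
* `exists_mikhlin_bound_of_homogeneous` — the bounds `‖D^N σ(ξ)‖ ≤ C_N ‖ξ‖^{(m:ℝ)−N}`;
* `exists_mikhlin_bound_inv_of_quadratic` — for `ℓ` smooth, `2`-homogeneous and positive off `0`
  (e.g. an elliptic quadratic form), `σ = ℓ⁻¹` satisfies the bounds with `m = −2`.

Everything is proved; no named facts.

## References

* H. Bahouri, J.-Y. Chemin, R. Danchin, *Fourier Analysis and Nonlinear PDE* (2011), Lemma 2.2.
  [BahouriCheminDanchin2011]
* D. Gilbarg, N. S. Trudinger, *Elliptic Partial Differential Equations of Second Order* (2001),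
  §4.3 / Thm. 9.9 (symbols of constant-coefficient operators). [GilbargTrudinger2001]
-/

noncomputable section

open Set Filter Metric Function
open scoped NNReal Topology ContDiff

namespace Literature.Analysis.FunctionSpaces

variable {E F : Type*} [NormedAddCommGroup E] [NormedSpace ℝ E] [NormedAddCommGroup F]
  [NormedSpace ℝ F]

/-- **Chain rule with a dilation, off the origin**: for `σ` smooth on `{0}ᶜ`, `t ≠ 0`, `ξ ≠ 0`,
`D^N (σ ∘ (t • ·)) (ξ) = (D^N σ (t • ξ)).compContinuousLinearMap (t • id)`. [folklore] -/
theorem iteratedFDeriv_comp_smul_of_ne {σ : E → F} (hσ : ContDiffOn ℝ ∞ σ {0}ᶜ) {t : ℝ} (ht : t ≠ 0)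
    {ξ : E} (hξ : ξ ≠ 0) (N : ℕ) :
    iteratedFDeriv ℝ N (fun η => σ (t • η)) ξ =
      (iteratedFDeriv ℝ N σ (t • ξ)).compContinuousLinearMap fun _ => t • ContinuousLinearMap.id ℝ E := by
  set g : E →L[ℝ] E := t • ContinuousLinearMap.id ℝ E with hg
  have hpre : g ⁻¹' ({0}ᶜ : Set E) = {0}ᶜ := by
    ext η
    simp [hg, smul_eq_zero, ht]
  have hopen : IsOpen ({0}ᶜ : Set E) := isOpen_compl_singleton
  have htξ : g ξ ∈ ({0}ᶜ : Set E) := by simp [hg, smul_eq_zero, ht, hξ]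
  have hud : UniqueDiffOn ℝ (g ⁻¹' ({0}ᶜ : Set E)) := by
    rw [hpre]
    exact hopen.uniqueDiffOn
  have h := g.iteratedFDerivWithin_comp_right (f := σ) hσ hopen.uniqueDiffOn hud (x := ξ) htξ
    (i := N) (by exact_mod_cast le_top)
  rw [hpre, iteratedFDerivWithin_of_isOpen N hopen (mem_compl_singleton_iff.2 hξ),
    iteratedFDerivWithin_of_isOpen N hopen htξ] at h
  exact h

omit [NormedSpace ℝ F] in
/-- Evaluating `A.compContinuousLinearMap (t • id)` multiplies by `t ^ N`. [folklore] -/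
theorem compContinuousLinearMap_smul_id_apply [NormedSpace ℝ F] {N : ℕ}
    (A : ContinuousMultilinearMap ℝ (fun _ : Fin N => E) F) (t : ℝ) (v : Fin N → E) :
    (A.compContinuousLinearMap fun _ => t • ContinuousLinearMap.id ℝ E) v = t ^ N • A v := by
  rw [ContinuousMultilinearMap.compContinuousLinearMap_apply]
  have h : (fun i => (t • ContinuousLinearMap.id ℝ E) (v i)) = fun i => (fun _ : Fin N => t) i • v i := by
    funext i
    simp
  rw [h, A.map_smul_univ, Fin.prod_const]

/-- **Derivatives of a homogeneous symbol are homogeneous**: if `σ` is smooth off `0` and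
`σ (t • ξ) = t ^ m • σ ξ` for all `t > 0`, `ξ ≠ 0` (`m ∈ ℤ`), then
`D^N σ (t • ξ) = t ^ (m − N) • D^N σ ξ`. [cite: BahouriCheminDanchin2011, Lemma 2.2] -/
theorem iteratedFDeriv_smul_eq_of_homogeneous {σ : E → F} (hσ : ContDiffOn ℝ ∞ σ {0}ᶜ) {m : ℤ}
    (hhom : ∀ (t : ℝ), 0 < t → ∀ ξ : E, ξ ≠ 0 → σ (t • ξ) = t ^ m • σ ξ) {t : ℝ} (ht : 0 < t)
    {ξ : E} (hξ : ξ ≠ 0) (N : ℕ) :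
    iteratedFDeriv ℝ N σ (t • ξ) = t ^ (m - N) • iteratedFDeriv ℝ N σ ξ := by
  have hopen : IsOpen ({0}ᶜ : Set E) := isOpen_compl_singleton
  -- `D^N (σ ∘ (t•)) ξ = t^m • D^N σ ξ` from the homogeneity on the open set `{0}ᶜ`
  have h1 : iteratedFDeriv ℝ N (fun η => σ (t • η)) ξ = (t ^ m : ℝ) • iteratedFDeriv ℝ N σ ξ := by
    have heq : EqOn (fun η => σ (t • η)) ((t ^ m : ℝ) • σ) {0}ᶜ := fun η hη => by
      simp only [Pi.smul_apply]
      exact hhom t ht η hη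
    rw [← iteratedFDerivWithin_of_isOpen N hopen (mem_compl_singleton_iff.2 hξ),
      ← iteratedFDerivWithin_of_isOpen N hopen (mem_compl_singleton_iff.2 hξ),
      iteratedFDerivWithin_congr heq (mem_compl_singleton_iff.2 hξ),
      iteratedFDerivWithin_const_smul_apply ((hσ ξ hξ).of_le (by exact_mod_cast le_top)) hopen.uniqueDiffOn
        (mem_compl_singleton_iff.2 hξ)]
  -- `D^N (σ ∘ (t•)) ξ = t^N • D^N σ (t • ξ)` from the chain rule
  have h2 : iteratedFDeriv ℝ N (fun η => σ (t • η)) ξ = (t ^ N : ℝ) • iteratedFDeriv ℝ N σ (t • ξ) := by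
    rw [iteratedFDeriv_comp_smul_of_ne hσ ht.ne' hξ N]
    ext v
    rw [compContinuousLinearMap_smul_id_apply, smul_apply]
  have h3 : (t ^ N : ℝ) • iteratedFDeriv ℝ N σ (t • ξ) = (t ^ m : ℝ) • iteratedFDeriv ℝ N σ ξ :=
    h2.symm.trans h1
  have htN : (t ^ N : ℝ) ≠ 0 := pow_ne_zero _ ht.ne'
  calc iteratedFDeriv ℝ N σ (t • ξ)
      = (t ^ N : ℝ)⁻¹ • ((t ^ N : ℝ) • iteratedFDeriv ℝ N σ (t • ξ)) := by
        rw [smul_smul, inv_mul_cancel₀ htN, one_smul]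
    _ = t ^ (m - N) • iteratedFDeriv ℝ N σ ξ := by
        rw [h3, smul_smul, zpow_sub₀ ht.ne', zpow_natCast, div_eq_inv_mul]

/-- **Mikhlin bounds for a homogeneous symbol**: with `σ` as above on a finite-dimensional space,
`‖D^N σ(ξ)‖ ≤ C_N ‖ξ‖^{(m:ℝ) − N}` for all `ξ ≠ 0`, where `C_N = sup_{‖η‖ = 1} ‖D^N σ(η)‖`.
[cite: BahouriCheminDanchin2011, Lemma 2.2] -/
theorem exists_mikhlin_bound_of_homogeneous [FiniteDimensional ℝ E] {σ : E → F}
    (hσ : ContDiffOn ℝ ∞ σ {0}ᶜ) {m : ℤ}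
    (hhom : ∀ (t : ℝ), 0 < t → ∀ ξ : E, ξ ≠ 0 → σ (t • ξ) = t ^ m • σ ξ) :
    ∃ C : ℕ → ℝ, ∀ (N : ℕ) (ξ : E), ξ ≠ 0 →
      ‖iteratedFDeriv ℝ N σ ξ‖ ≤ C N * ‖ξ‖ ^ ((m : ℝ) - N) := by
  have hopen : IsOpen ({0}ᶜ : Set E) := isOpen_compl_singleton
  -- `D^N σ` is continuous on the unit sphere, hence bounded there
  have hcont : ∀ N : ℕ, ContinuousOn (iteratedFDeriv ℝ N σ) (sphere (0 : E) 1) := by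
    intro N
    have h1 : ContinuousOn (iteratedFDerivWithin ℝ N σ {0}ᶜ) {0}ᶜ :=
      hσ.continuousOn_iteratedFDerivWithin (by exact_mod_cast le_top) hopen.uniqueDiffOn
    have hsub : sphere (0 : E) 1 ⊆ ({0}ᶜ : Set E) := fun η hη => by
      rw [mem_compl_singleton_iff]
      rintro rfl
      simp at hη
    exact (h1.congr (fun η hη => (iteratedFDerivWithin_of_isOpen N hopen hη).symm)).mono hsub
  choose C hC using fun N => (isCompact_sphere (0 : E) 1).exists_bound_of_continuousOn (hcont N)
  refine ⟨C, fun N ξ hξ => ?_⟩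
  -- `ξ = ‖ξ‖ • η` with `‖η‖ = 1`
  have hnorm : 0 < ‖ξ‖ := norm_pos_iff.2 hξ
  set η : E := ‖ξ‖⁻¹ • ξ with hη
  have hη1 : ‖η‖ = 1 := by
    rw [hη, norm_smul, norm_inv, norm_norm, inv_mul_cancel₀ hnorm.ne']
  have hηs : η ∈ sphere (0 : E) 1 := by simp [hη1]
  have hη0 : η ≠ 0 := by
    rintro h
    rw [h, norm_zero] at hη1
    exact zero_ne_one hη1
  have hξη : ξ = ‖ξ‖ • η := by
    rw [hη, smul_smul, mul_inv_cancel₀ hnorm.ne', one_smul]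
  rw [hξη, iteratedFDeriv_smul_eq_of_homogeneous hσ hhom hnorm hη0 N, norm_smul, norm_smul,
    hη1, mul_one, mul_comm]
  refine mul_le_mul (hC N η hηs) ?_ (norm_nonneg _) ((norm_nonneg _).trans (hC N η hηs))
  rw [Real.norm_eq_abs, abs_of_pos (zpow_pos hnorm _), norm_norm, ← Real.rpow_intCast]
  push_cast
  exact le_rfl

/-- **The parametrix symbol of a constant-coefficient elliptic operator**: if `ℓ : E → ℝ` is
smooth off `0`, positively `2`-homogeneous and positive off `0` (e.g. `ℓ(ξ) = ∑ aᵢⱼ ξᵢ ξⱼ` with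
`λ‖ξ‖² ≤ ℓ(ξ)`), then `σ = ℓ⁻¹` satisfies the Mikhlin bounds with `m = −2`.
[cite: GilbargTrudinger2001, §4.3] -/
theorem exists_mikhlin_bound_inv_of_quadratic [FiniteDimensional ℝ E] {ℓ : E → ℝ}
    (hℓ : ContDiffOn ℝ ∞ ℓ {0}ᶜ) (hhom : ∀ (t : ℝ), 0 < t → ∀ ξ : E, ξ ≠ 0 → ℓ (t • ξ) = t ^ 2 * ℓ ξ)
    (hpos : ∀ ξ : E, ξ ≠ 0 → 0 < ℓ ξ) :
    ∃ C : ℕ → ℝ, ∀ (N : ℕ) (ξ : E), ξ ≠ 0 →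
      ‖iteratedFDeriv ℝ N (fun ξ => (ℓ ξ)⁻¹) ξ‖ ≤ C N * ‖ξ‖ ^ ((-2 : ℝ) - N) := by
  have hσ : ContDiffOn ℝ ∞ (fun ξ => (ℓ ξ)⁻¹) {0}ᶜ :=
    hℓ.inv fun ξ hξ => (hpos ξ hξ).ne'
  have hhom' : ∀ (t : ℝ), 0 < t → ∀ ξ : E, ξ ≠ 0 →
      (fun ξ => (ℓ ξ)⁻¹) (t • ξ) = t ^ (-2 : ℤ) • (fun ξ => (ℓ ξ)⁻¹) ξ := by
    intro t ht ξ hξ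
    simp only [smul_eq_mul, hhom t ht ξ hξ, mul_inv, zpow_neg, zpow_ofNat]
  have h := exists_mikhlin_bound_of_homogeneous hσ hhom'
  push_cast at h
  exact h

end Literature.Analysis.FunctionSpaces

end
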